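import Mathlib
import Summits.ValiantsHypothesis.ValiantsHypothesis.Theses.ChowBorderDepth3

/-!
# Stub `stub_interpolate` of crux `ChowBorderDepth3.ChowBorderBound` (stmt-ValiantsHypothesis-5936),
# line `registered` (vertex normal form): degree-`n` extraction by interpolation

Route `ValiantsHypothesis/ChowBorderDepth3`, crux `ChowBorderBound`, line `registered`.  The line
normalises a border `ΣΠΣ` expression of the padded permanent to the vertex (local) form in three
steps translate → interpolate → rescale; this file is the second step.

**Statement.**  Let `ε = Polynomial.X`, let `τ_u = aeval (X_v ↦ X_v + u_v)` be a translation, and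
suppose

  `F := Σ_{i<r} a_i · Π_{j<D} (c_ij + Σ_v L_ijv X_v) = τ_u (ε^q · per_n + ε^(q+1) · G)`

over `ℂ[ε]` with all `c_ij ≠ 0`.  Then there are `r (D+1)` summands of the same shape (constant
terms still non-zero) and a FORM `G'` of degree `n` with

  `Σ_{p<r(D+1)} a'_p · Π_{j<D} (c'_pj + Σ_v L'_pjv X_v) = ε^q · per_n + ε^(q+1) · G'`.

**Proof.**  (1) `deg F ≤ D`.  (2) Scaling lemma: `φ(t X) = Σ_{d ≤ D} t^d φ_d` for
`deg φ ≤ D` (`aeval_C_mul_X_eq_sum`).  (3) Lagrange weights: for the nodes `0, …, D` there are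
`w_k ∈ ℂ` with `Σ_k w_k k^d = [d = n]` for `d ≤ D` (coefficient of `X^n` in
`X^d = Σ_k k^d ℓ_k`, `Lagrange.eq_interpolate`), whence `Σ_k w_k F(k X) = F_n`
(`sum_C_mul_aeval_eq_homogeneousComponent`; if `n > D` both sides vanish).  (4) Each
`w_k F(k X)` is again a weighted sum of `r` products of affine forms with the same constant
terms (`a'_{ik} = a_i w_k`, `L'_{ikjv} = L_ijv k`); reindex by `finProdFinEquiv`.
(5) `F_n = ε^q per_n + ε^(q+1) (τ_u G)_n` by linearity and the translation lemma
`(τ_u P)_n = P` for a form `P` of degree `n` (`homogeneousComponent_aeval_X_add_C`, from the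
multiplicativity of top homogeneous components, `homogeneousComponent_mul_of_le`); take
`G' = (τ_u G)_n`.

References: J. M. Landsberg, *Geometry and complexity theory*, CUP 2017, §7.5.3 (border Chow
rank of the padded permanent); the interpolation/homogenisation step is folklore (e.g.
P. Bürgisser, *Completeness and reduction in algebraic complexity theory*, Springer 2000, §2.1).
-/

noncomputable section

-- `Summit.ValiantsHypothesis.ValiantsHypothesis.…` is the tree's mandated single-conjunct layout
-- (Sub = Summit), so the duplicated namespace component is intended.
set_option linter.dupNamespace false

namespace Summit.ValiantsHypothesis.ValiantsHypothesis.Theorems.ChowBorderBound.Interpolate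

open MvPolynomial Literature.Computability.AlgebraicComplexity
open scoped Polynomial

/-! ## Top homogeneous components of products, translates and scalings -/

section General

variable {σ R : Type*} [CommSemiring R]

/-- A polynomial of total degree `≤ N` is the sum of its homogeneous components of degree
`≤ N`. [folklore] -/
theorem sum_homogeneousComponent_of_le (φ : MvPolynomial σ R) {N : ℕ}
    (hN : φ.totalDegree ≤ N) :
    ∑ d ∈ Finset.range (N + 1), homogeneousComponent d φ = φ := by
  conv_rhs => rw [← sum_homogeneousComponent φ]
  refine (Finset.sum_subset (Finset.range_subset_range.2 (by omega)) fun d _ hd => ?_).symm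
  rw [Finset.mem_range] at hd
  exact homogeneousComponent_eq_zero _ _ (by omega)

/-- **Top homogeneous components are multiplicative**: if `deg f ≤ a` and `deg g ≤ b` then
`(f g)_{a+b} = f_a g_b`. [folklore] -/
theorem homogeneousComponent_mul_of_le {f g : MvPolynomial σ R} {a b : ℕ}
    (ha : f.totalDegree ≤ a) (hb : g.totalDegree ≤ b) :
    homogeneousComponent (a + b) (f * g) =
      homogeneousComponent a f * homogeneousComponent b g := by
  have hf := sum_homogeneousComponent_of_le f ha
  have hg := sum_homogeneousComponent_of_le g hb
  calc homogeneousComponent (a + b) (f * g)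
      = homogeneousComponent (a + b)
          ((∑ i ∈ Finset.range (a + 1), homogeneousComponent i f) *
            ∑ j ∈ Finset.range (b + 1), homogeneousComponent j g) := by rw [hf, hg]
    _ = ∑ i ∈ Finset.range (a + 1), ∑ j ∈ Finset.range (b + 1),
          homogeneousComponent (a + b) (homogeneousComponent i f * homogeneousComponent j g) := by
        rw [Finset.sum_mul_sum]
        simp only [map_sum]
    _ = homogeneousComponent a f * homogeneousComponent b g := by
        rw [Finset.sum_eq_single a]
        · rw [Finset.sum_eq_single b]
          · exact homogeneousComponent_eq_self ((homogeneousComponent_isHomogeneous a f).mul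
              (homogeneousComponent_isHomogeneous b g))
          · intro j hj hjb
            rw [Finset.mem_range] at hj
            rw [homogeneousComponent_of_mem ((homogeneousComponent_isHomogeneous a f).mul
              (homogeneousComponent_isHomogeneous j g)), if_neg]
            omega
          · intro h
            exact absurd (Finset.self_mem_range_succ b) h
        · intro i hi hia
          rw [Finset.mem_range] at hi
          refine Finset.sum_eq_zero fun j hj => ?_
          rw [Finset.mem_range] at hj
          rw [homogeneousComponent_of_mem ((homogeneousComponent_isHomogeneous i f).mul
            (homogeneousComponent_isHomogeneous j g)), if_neg]
          omega
        · intro h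
          exact absurd (Finset.self_mem_range_succ a) h

/-- Top homogeneous component of a product with tight degree bounds:
`(∏ f_i)_{Σ d_i} = ∏ (f_i)_{d_i}` when `deg f_i ≤ d_i`. [folklore] -/
theorem homogeneousComponent_prod_of_le {ι : Type*} (s : Finset ι) (f : ι → MvPolynomial σ R)
    (d : ι → ℕ) (h : ∀ i ∈ s, (f i).totalDegree ≤ d i) :
    homogeneousComponent (∑ i ∈ s, d i) (∏ i ∈ s, f i) =
      ∏ i ∈ s, homogeneousComponent (d i) (f i) := by
  induction s using Finset.cons_induction with
  | empty => simp
  | cons a s _ ih =>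
    rw [Finset.sum_cons, Finset.prod_cons, Finset.prod_cons,
      homogeneousComponent_mul_of_le (h a (Finset.mem_cons_self a s))
        ((totalDegree_finsetProd s f).trans
          (Finset.sum_le_sum fun i hi => h i (Finset.mem_cons_of_mem hi))),
      ih fun i hi => h i (Finset.mem_cons_of_mem hi)]

/-- An affine-linear form `X_v + c` has total degree `≤ 1`. [folklore] -/
theorem totalDegree_X_add_C_le (v : σ) (c : R) :
    (X v + C c : MvPolynomial σ R).totalDegree ≤ 1 :=
  (totalDegree_add _ _).trans
    (max_le (isHomogeneous_X R v).totalDegree_le (by rw [totalDegree_C]; exact zero_le_one))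

/-- `((X_v + c)^k)_k = X_v^k`: translation only adds lower-order terms to a power. [folklore] -/
theorem homogeneousComponent_X_add_C_pow (v : σ) (c : R) (k : ℕ) :
    homogeneousComponent k ((X v + C c) ^ k) = X v ^ k := by
  have h := homogeneousComponent_prod_of_le (Finset.range k) (fun _ => X v + C c) (fun _ => 1)
    fun _ _ => totalDegree_X_add_C_le v c
  rw [Finset.sum_const, Finset.card_range, smul_eq_mul, mul_one, Finset.prod_const,
    Finset.card_range, Finset.prod_const, Finset.card_range, map_add,
    homogeneousComponent_eq_self (isHomogeneous_X R v),
    homogeneousComponent_of_mem (isHomogeneous_C σ c), if_neg one_ne_zero, add_zero] at h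
  exact h

/-- `(∏_v (X_v + u_v)^{m_v})_{|m|} = X^m`: the top component of a translated monomial is the
monomial. [folklore] -/
theorem homogeneousComponent_prod_X_add_C_pow (u : σ → R) (m : σ →₀ ℕ) :
    homogeneousComponent m.degree (m.prod fun v e => (X v + C (u v)) ^ e) = monomial m 1 := by
  rw [Finsupp.degree_apply, Finsupp.prod, homogeneousComponent_prod_of_le m.support _
    (fun v => m v) fun v _ => ((totalDegree_pow _ _).trans
      ((Nat.mul_le_mul_left _ (totalDegree_X_add_C_le v (u v))).trans (mul_one _).le)),
    Finset.prod_congr rfl fun v _ => homogeneousComponent_X_add_C_pow v (u v) (m v)]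
  exact prod_X_pow_eq_monomial

/-- **Translation lemma**: for a form `P` of degree `N`, the degree-`N` component of the
translate `P(X + u)` is `P` itself. [folklore] -/
theorem homogeneousComponent_aeval_X_add_C {P : MvPolynomial σ R} {N : ℕ}
    (hP : P.IsHomogeneous N) (u : σ → R) :
    homogeneousComponent N (aeval (fun v => X v + C (u v)) P) = P := by
  classical
  rw [P.as_sum]
  simp only [map_sum]
  refine Finset.sum_congr rfl fun m hm => ?_
  have hmd : m.degree = N := by
    rw [Finsupp.degree_eq_weight_one]; exact hP (mem_support_iff.mp hm)
  rw [aeval_monomial, algebraMap_eq, homogeneousComponent_C_mul, ← hmd]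
  rw [homogeneousComponent_prod_X_add_C_pow u m, C_mul_monomial, mul_one]

/-- **Scaling a form**: `ψ(t X) = t^d ψ(X)` for `ψ` homogeneous of degree `d`. [folklore] -/
theorem aeval_C_mul_X_of_isHomogeneous {ψ : MvPolynomial σ R} {d : ℕ}
    (hψ : ψ.IsHomogeneous d) (t : R) :
    aeval (fun v => C t * X v) ψ = C (t ^ d) * ψ := by
  -- adapted from `Literature.RingTheory.MvPolynomial.aeval_mul_const_of_isHomogeneous`
  classical
  rw [ψ.as_sum, map_sum, Finset.mul_sum]
  refine Finset.sum_congr rfl fun m hm => ?_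
  have hmd : ∑ v ∈ m.support, m v = d := by
    rw [← Finsupp.degree_apply, Finsupp.degree_eq_weight_one]
    exact hψ (mem_support_iff.mp hm)
  rw [aeval_monomial, algebraMap_eq, monomial_eq, Finsupp.prod, Finsupp.prod]
  simp only [mul_pow, Finset.prod_mul_distrib, ← map_pow, ← map_prod,
    Finset.prod_pow_eq_pow_sum, hmd]
  ring

/-- **Scaling lemma**: `φ(t X) = Σ_{d ≤ N} t^d φ_d` whenever `deg φ ≤ N`. [folklore] -/
theorem aeval_C_mul_X_eq_sum {φ : MvPolynomial σ R} {N : ℕ} (hN : φ.totalDegree ≤ N)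
    (t : R) :
    aeval (fun v => C t * X v) φ =
      ∑ d ∈ Finset.range (N + 1), C (t ^ d) * homogeneousComponent d φ := by
  conv_lhs => rw [← sum_homogeneousComponent_of_le φ hN, map_sum]
  exact Finset.sum_congr rfl fun d _ =>
    aeval_C_mul_X_of_isHomogeneous (homogeneousComponent_isHomogeneous d φ) t

/-- Scaling a weighted product of affine forms rescales the linear parts. [folklore] -/
theorem aeval_C_mul_X_affine [Fintype σ] {D : ℕ} (t a : R) (c : Fin D → R)
    (L : Fin D → σ → R) :
    aeval (fun v => C t * X v) (C a * ∏ j, (C (c j) + ∑ v, C (L j v) * X v)) =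
      C a * ∏ j, (C (c j) + ∑ v, C (L j v * t) * X v) := by
  simp only [map_mul, map_prod, map_add, map_sum, aeval_C, aeval_X, algebraMap_eq, mul_assoc]

/-- An affine form `c + Σ_v L_v X_v` has total degree `≤ 1`. [folklore] -/
theorem totalDegree_affine_le [Fintype σ] (c : R) (L : σ → R) :
    (C c + ∑ v, C (L v) * X v : MvPolynomial σ R).totalDegree ≤ 1 := by
  refine (totalDegree_add _ _).trans (max_le (by rw [totalDegree_C]; exact zero_le_one) ?_)
  exact totalDegree_finsetSum_le fun v _ => (isHomogeneous_C_mul_X (L v) v).totalDegree_le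

/-- A weighted product of `D` affine forms has total degree `≤ D`. [folklore] -/
theorem totalDegree_C_mul_prod_affine_le [Fintype σ] {D : ℕ} (a : R) (c : Fin D → R)
    (L : Fin D → σ → R) :
    (C a * ∏ j, (C (c j) + ∑ v, C (L j v) * X v) : MvPolynomial σ R).totalDegree ≤ D := by
  refine (totalDegree_mul _ _).trans ?_
  rw [totalDegree_C, zero_add]
  refine (totalDegree_finsetProd _ _).trans ?_
  calc ∑ j, (C (c j) + ∑ v, C (L j v) * X v : MvPolynomial σ R).totalDegree
      ≤ ∑ _j : Fin D, 1 := Finset.sum_le_sum fun j _ => totalDegree_affine_le (c j) (L j)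
    _ = D := by simp

end General

/-! ## Interpolation of the degree-`n` component over `ℂ[ε]` -/

section Interpolation

variable {σ : Type*}

/-- **Lagrange weights**: for the nodes `0, 1, …, D` there are weights `w_k ∈ ℂ` with
`Σ_k w_k k^d = [d = n]` for all `d ≤ D` (the coefficient of `X^n` in the Lagrange interpolation
formula `X^d = Σ_k k^d ℓ_k`). [folklore] -/
theorem exists_lagrange_weights (D n : ℕ) :
    ∃ w : Fin (D + 1) → ℂ,
      ∀ d ≤ D, (∑ k, w k * ((k : ℕ) : ℂ) ^ d) = if d = n then 1 else 0 := by
  classical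
  have hv : Set.InjOn (fun k : Fin (D + 1) => ((k : ℕ) : ℂ))
      (Finset.univ : Finset (Fin (D + 1))) :=
    fun i _ j _ h => Fin.ext (Nat.cast_injective h)
  refine ⟨fun k =>
    (Lagrange.basis Finset.univ (fun k : Fin (D + 1) => ((k : ℕ) : ℂ)) k).coeff n, fun d hd => ?_⟩
  have hdeg : ((Polynomial.X : ℂ[X]) ^ d).degree < (Finset.univ : Finset (Fin (D + 1))).card := by
    rw [Polynomial.degree_X_pow, Finset.card_univ, Fintype.card_fin]
    exact_mod_cast Nat.lt_succ_of_le hd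
  have key := congrArg (fun p : ℂ[X] => p.coeff n) (Lagrange.eq_interpolate hv hdeg)
  simp only [Lagrange.interpolate_apply, Polynomial.eval_pow, Polynomial.eval_X,
    Polynomial.coeff_X_pow, Polynomial.finsetSum_coeff, Polynomial.coeff_C_mul] at key
  calc ∑ k : Fin (D + 1),
        (Lagrange.basis Finset.univ (fun k : Fin (D + 1) => ((k : ℕ) : ℂ)) k).coeff n *
          ((k : ℕ) : ℂ) ^ d
      = ∑ k : Fin (D + 1), ((k : ℕ) : ℂ) ^ d *
          (Lagrange.basis Finset.univ (fun k : Fin (D + 1) => ((k : ℕ) : ℂ)) k).coeff n :=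
        Finset.sum_congr rfl fun k _ => mul_comm _ _
    _ = if n = d then 1 else 0 := key.symm
    _ = if d = n then 1 else 0 := by
        by_cases h : n = d
        · rw [if_pos h, if_pos h.symm]
        · rw [if_neg h, if_neg (Ne.symm h)]

/-- **Degree extraction by interpolation**: with Lagrange weights `w` for the nodes `0, …, D`,
`Σ_k w_k · φ(k X) = φ_n` for every `φ` of total degree `≤ D`. [folklore] -/
theorem sum_C_mul_aeval_eq_homogeneousComponent {D n : ℕ} {w : Fin (D + 1) → ℂ}
    (hw : ∀ d ≤ D, (∑ k, w k * ((k : ℕ) : ℂ) ^ d) = if d = n then 1 else 0)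
    {φ : MvPolynomial σ ℂ[X]} (hφ : φ.totalDegree ≤ D) :
    ∑ k, C (Polynomial.C (w k)) *
        aeval (fun v => C (Polynomial.C ((k : ℕ) : ℂ)) * X v) φ =
      homogeneousComponent n φ := by
  classical
  have h1 : ∀ k : Fin (D + 1), C (Polynomial.C (w k)) *
      aeval (fun v => C (Polynomial.C ((k : ℕ) : ℂ)) * X v) φ =
        ∑ d ∈ Finset.range (D + 1), C (Polynomial.C (w k * ((k : ℕ) : ℂ) ^ d)) *
          homogeneousComponent d φ := by
    intro k
    rw [aeval_C_mul_X_eq_sum hφ, Finset.mul_sum]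
    refine Finset.sum_congr rfl fun d _ => ?_
    rw [← mul_assoc, ← map_pow, ← map_mul, ← map_mul]
  have h2 : ∀ d ∈ Finset.range (D + 1),
      ∑ k, C (Polynomial.C (w k * ((k : ℕ) : ℂ) ^ d)) * homogeneousComponent d φ =
        if d = n then homogeneousComponent d φ else 0 := by
    intro d hd
    have hsum : ∑ k, (C (Polynomial.C (w k * ((k : ℕ) : ℂ) ^ d)) : MvPolynomial σ ℂ[X]) =
        C (Polynomial.C (∑ k, w k * ((k : ℕ) : ℂ) ^ d)) := by
      rw [map_sum, map_sum]
    rw [← Finset.sum_mul, hsum, hw d (by rw [Finset.mem_range] at hd; omega)]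
    split_ifs
    · rw [map_one, map_one, one_mul]
    · rw [map_zero, map_zero, zero_mul]
  rw [Finset.sum_congr rfl fun k _ => h1 k, Finset.sum_comm, Finset.sum_congr rfl h2,
    Finset.sum_ite_eq']
  split_ifs with h
  · rfl
  · rw [Finset.mem_range, not_lt] at h
    exact (homogeneousComponent_eq_zero _ _ (by omega)).symm

/-- Scaling and weighting a border `ΣΠΣ` expression summand by summand. [folklore] -/
theorem sum_C_mul_aeval_sps {n r D : ℕ} (w : Fin (D + 1) → ℂ) (a : Fin r → ℂ[X])
    (c : Fin r → Fin D → ℂ[X]) (L : Fin r → Fin D → Fin n × Fin n → ℂ[X]) :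
    ∑ k, C (Polynomial.C (w k)) * aeval (fun v => C (Polynomial.C ((k : ℕ) : ℂ)) * X v)
        (∑ i, C (a i) * ∏ j, (C (c i j) + ∑ v, C (L i j v) * X v)) =
      ∑ i, ∑ k, C (a i * Polynomial.C (w k)) *
        ∏ j, (C (c i j) + ∑ v, C (L i j v * Polynomial.C ((k : ℕ) : ℂ)) * X v) := by
  rw [Finset.sum_comm]
  refine Finset.sum_congr rfl fun k _ => ?_
  rw [map_sum, Finset.mul_sum]
  refine Finset.sum_congr rfl fun i _ => ?_
  rw [aeval_C_mul_X_affine, ← mul_assoc, ← map_mul, mul_comm (Polynomial.C (w k))]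

end Interpolation

/-! ## The stub -/

/-- **Stub `stub_interpolate`** (registered stub of crux stmt-ValiantsHypothesis-5936, line
`registered`): degree-`n` extraction.  If `Σ_{i<r} a_i Π_{j<D} (c_ij + Σ_v L_ijv X_v)` (all
`c_ij ≠ 0`) equals the translate `τ_u (ε^q per_n + ε^(q+1) G)`, then some expression of the same
shape with `r (D+1)` summands (constant terms still non-zero) equals `ε^q per_n + ε^(q+1) G'`
with `G'` a form of degree `n`: interpolate the degree-`n` component with Lagrange weights at
the scalings `X ↦ k X`, `k = 0, …, D`, and use that translation fixes the top component of the
form `per_n`. [folklore] -/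
theorem stub_interpolate :
    ∀ n r D : ℕ,
    (∃ (q : ℕ) (u : Fin n × Fin n → Polynomial ℂ) (a : Fin r → Polynomial ℂ)
        (c : Fin r → Fin D → Polynomial ℂ) (L : Fin r → Fin D → Fin n × Fin n → Polynomial ℂ)
        (G : MvPolynomial (Fin n × Fin n) (Polynomial ℂ)),
        (∀ i j, c i j ≠ 0) ∧
        (∑ i, MvPolynomial.C (a i) *
            ∏ j, (MvPolynomial.C (c i j) + ∑ v, MvPolynomial.C (L i j v) * MvPolynomial.X v)) =
          MvPolynomial.aeval (fun v => MvPolynomial.X v + MvPolynomial.C (u v))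
            (MvPolynomial.C (Polynomial.X ^ q) *
                MvPolynomial.map Polynomial.C
                  (Literature.Computability.AlgebraicComplexity.perPoly (Fin n) ℂ) +
              MvPolynomial.C (Polynomial.X ^ (q + 1)) * G)) →
    ∃ (q : ℕ) (a : Fin (r * (D + 1)) → Polynomial ℂ)
      (c : Fin (r * (D + 1)) → Fin D → Polynomial ℂ)
      (L : Fin (r * (D + 1)) → Fin D → Fin n × Fin n → Polynomial ℂ)
      (G : MvPolynomial (Fin n × Fin n) (Polynomial ℂ)),
      (∀ i j, c i j ≠ 0) ∧ G.IsHomogeneous n ∧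
      (∑ i, MvPolynomial.C (a i) *
          ∏ j, (MvPolynomial.C (c i j) + ∑ v, MvPolynomial.C (L i j v) * MvPolynomial.X v)) =
        MvPolynomial.C (Polynomial.X ^ q) *
            MvPolynomial.map Polynomial.C
              (Literature.Computability.AlgebraicComplexity.perPoly (Fin n) ℂ) +
          MvPolynomial.C (Polynomial.X ^ (q + 1)) * G := by
  intro n r D
  rintro ⟨q, u, a, c, L, G, hc, hF⟩
  obtain ⟨w, hw⟩ := exists_lagrange_weights D n
  -- (1) the expression `F` has total degree `≤ D`
  have hdeg : (∑ i, C (a i) * ∏ j, (C (c i j) + ∑ v, C (L i j v) * X v) :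
      MvPolynomial (Fin n × Fin n) ℂ[X]).totalDegree ≤ D :=
    totalDegree_finsetSum_le fun i _ => totalDegree_C_mul_prod_affine_le (a i) (c i) (L i)
  -- (5) right side: the degree-`n` component of the translate of `ε^q per_n + ε^(q+1) G`
  have hPer : (map Polynomial.C (perPoly (Fin n) ℂ)).IsHomogeneous n := by
    have h := (perPoly_isHomogeneous (n := Fin n) (k := ℂ)).map Polynomial.C
    rwa [Fintype.card_fin] at h
  have hcomp : homogeneousComponent n
      (∑ i, C (a i) * ∏ j, (C (c i j) + ∑ v, C (L i j v) * X v) :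
        MvPolynomial (Fin n × Fin n) ℂ[X]) =
      C (Polynomial.X ^ q) * map Polynomial.C (perPoly (Fin n) ℂ) +
        C (Polynomial.X ^ (q + 1)) *
          homogeneousComponent n (aeval (fun v => X v + C (u v)) G) := by
    rw [hF]
    simp only [map_add, map_mul, aeval_C, algebraMap_eq, homogeneousComponent_C_mul]
    rw [homogeneousComponent_aeval_X_add_C hPer]
  -- (3)-(4) the new expression, indexed by `Fin r × Fin (D + 1) ≃ Fin (r * (D + 1))`
  refine ⟨q, fun p => a (finProdFinEquiv.symm p).1 * Polynomial.C (w (finProdFinEquiv.symm p).2),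
    fun p j => c (finProdFinEquiv.symm p).1 j,
    fun p j v => L (finProdFinEquiv.symm p).1 j v *
      Polynomial.C (((finProdFinEquiv.symm p).2 : ℕ) : ℂ),
    homogeneousComponent n (aeval (fun v => X v + C (u v)) G),
    fun p j => hc _ _, homogeneousComponent_isHomogeneous _ _, ?_⟩
  rw [← hcomp, ← sum_C_mul_aeval_eq_homogeneousComponent hw hdeg, sum_C_mul_aeval_sps,
    ← (finProdFinEquiv (m := r) (n := D + 1)).sum_comp]
  simp only [Equiv.symm_apply_apply, Fintype.sum_prod_type]

end Summit.ValiantsHypothesis.ValiantsHypothesis.Theorems.ChowBorderBound.Interpolate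

end
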